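import Summits.NavierStokesRegularity.NavierStokesRegularity.Theorems.ExtremiserTransienceTwoThirdsRemainderPointwise
import HarnessLib

/-!
# Route `ExtremiserTransience`, crux `NearExtremalTransiencePerFlow` (stmt-NavierStokesRegularity-26567), LINE g10-1 «two_thirds»
# (ns-idea-10 g10), stub S2 `FirstOrderIdentity`: the REMAINDER ESTIMATE `|a₁(χ·G)|` (integrated form)

Helper file for S2 (`--supports stmt-NavierStokesRegularity-26567`), sequel of `…TwoThirdsRemainderPointwise`.  For smooth `V, G`,
a smooth compactly supported weight `χ` with `|χ| ≤ 1_S`, `‖Dχ‖ ≤ k₁·1_L`, `‖D²χ‖ ≤ k₂·1_L` (bounded measurable `S, L`), and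
bounds `‖G‖ ≤ g₀`, `‖DG‖ ≤ g₁`, `‖D²G‖ ≤ g₂` on an open `T ⊇ tsupport χ`, `‖DV‖ ≤ A₁`:

  `|a₁(χ·G)| ≤ (2A₁+κ⋆)·c·(g₁∫_S‖ω‖ + k₁g₀∫_L‖ω‖) + (g₁∫_S|ω|² + k₁g₀∫_L|ω|²) + 3κ⋆·c·(g₂∫_S√wd + (2k₁g₁+k₂g₀)∫_L√wd)`,

`c = ‖curlCLM‖` (`abs_a1_smul_le`).  In S2: `G = ∇q` (harmonic remainder of the gauge, `g_j ≲ A_E R^{-1-j}` by `…TwoThirdsGaugeFar`),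
`S = B(c,R+ℓ)`, `L` = the layer, `k_j ≲ ℓ^{-j}`.  No `curl G = 0` is needed.
HONEST FRAMING: calculus/measure bookkeeping; nothing about Navier–Stokes regularity or blow-up is proved; S2, the crux ⟨26567⟩
and NS regularity are OPEN; no summit is proved by a line. [folklore]
-/

noncomputable section

open scoped Topology InnerProductSpace RealInnerProductSpace ENNReal ContDiff
open MeasureTheory Filter Set Metric
open Literature.Analysis.FluidPDE
open Summit.NavierStokesRegularity.NavierStokesRegularity.Theorems.DepletionLadder.KStar.HalfSpace
open Summit.NavierStokesRegularity.NavierStokesRegularity.Theorems.DepletionLadder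
open Summit.NavierStokesRegularity.NavierStokesRegularity.Theorems.NearExtremalTransiencePerFlow.LocalMaximiser

namespace Summit.NavierStokesRegularity.NavierStokesRegularity.Theorems.NearExtremalTransiencePerFlow.TwoThirds

-- the summit's namespace repeats the problem name by convention (D-0017)
set_option linter.dupNamespace false

variable {V G : E3 → E3} {χ : E3 → ℝ}

/-- Off the support of `χ` the `a₁`-density of the direction `χ·G` vanishes. [folklore] -/
theorem a1Integrand_eq_zero_of_notMem_tsupport {x : E3} (hx : x ∉ tsupport χ) :
    c1 V (fun y => χ y • G y) x - (kStar / 2) * ((1 : ℝ)⁻¹ * (2 * z1 V (fun y => χ y • G y) x) +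
      1 * (2 * w1 V (fun y => χ y • G y) x)) = 0 := by
  have h0 : (fun y => χ y • G y) =ᶠ[𝓝 x] fun _ => (0 : E3) := by
    filter_upwards [(notMem_tsupport_iff_eventuallyEq.1 hx)] with y hy
    simp [hy]
  have hD : fderiv ℝ (fun y => χ y • G y) x = 0 := by
    rw [h0.fderiv_eq]; simp
  have hcurl : ∀ y, (fun y => χ y • G y) =ᶠ[𝓝 y] (fun _ => (0 : E3)) → curl (fun y => χ y • G y) y = 0 := by
    intro y hy
    rw [curl_eq_curlCLM, hy.fderiv_eq]; simp
  have hc : curl (fun y => χ y • G y) x = 0 := hcurl x h0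
  have hDc : fderiv ℝ (curl fun y => χ y • G y) x = 0 := by
    have hev : curl (fun y => χ y • G y) =ᶠ[𝓝 x] fun _ => (0 : E3) := by
      filter_upwards [h0.eventuallyEq_nhds] with y hy
      exact hcurl y hy
    rw [hev.fderiv_eq]; simp
  unfold c1 z1 w1
  rw [hc, hD, hDc]
  simp

/-- Set integrals of an indicator-weighted nonnegative continuous density. -/
theorem integral_indicator_mul_eq {f : E3 → ℝ} (hf : Continuous f) {S : Set E3} (hSm : MeasurableSet S)
    (hSb : Bornology.IsBounded S) (a : ℝ) :
    Integrable (fun x => a * S.indicator (fun _ => (1 : ℝ)) x * f x) ∧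
      ∫ x, a * S.indicator (fun _ => (1 : ℝ)) x * f x = a * ∫ x in S, f x := by
  obtain ⟨ρ, hρ⟩ := hSb.subset_closedBall (0 : E3)
  have hint : IntegrableOn f S := (hf.continuousOn.integrableOn_compact (isCompact_closedBall 0 ρ)).mono_set hρ
  have e : (fun x => a * S.indicator (fun _ => (1 : ℝ)) x * f x) = fun x => a * S.indicator f x := by
    funext x
    by_cases hx : x ∈ S
    · simp [indicator_of_mem hx]
    · simp [indicator_of_notMem hx]
  rw [e]
  refine ⟨(hint.integrable_indicator hSm).const_mul a, ?_⟩
  rw [integral_const_mul, integral_indicator hSm]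

/-- **THE REMAINDER ESTIMATE** (integrated form; see the module docstring). [folklore] -/
theorem abs_a1_smul_le (hV : ContDiff ℝ (⊤ : ℕ∞) V) (hG : ContDiff ℝ (⊤ : ℕ∞) G) (hχ : ContDiff ℝ (⊤ : ℕ∞) χ)
    {T S L : Set E3} (hT : tsupport χ ⊆ T) (hSm : MeasurableSet S) (hLm : MeasurableSet L)
    (hSb : Bornology.IsBounded S) (hLb : Bornology.IsBounded L)
    {A₁ g₀ g₁ g₂ k₁ k₂ : ℝ} (hg₀0 : 0 ≤ g₀) (hg₁0 : 0 ≤ g₁) (hg₂0 : 0 ≤ g₂) (hA : ∀ x, ‖fderiv ℝ V x‖ ≤ A₁)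
    (hg₀ : ∀ x ∈ T, ‖G x‖ ≤ g₀) (hg₁ : ∀ x ∈ T, ‖fderiv ℝ G x‖ ≤ g₁) (hg₂ : ∀ x ∈ T, ‖iteratedFDeriv ℝ 2 G x‖ ≤ g₂)
    (hχS : ∀ x, |χ x| ≤ S.indicator (fun _ => (1 : ℝ)) x)
    (hk₁ : ∀ x, ‖fderiv ℝ χ x‖ ≤ k₁ * L.indicator (fun _ => (1 : ℝ)) x)
    (hk₂ : ∀ x, ‖iteratedFDeriv ℝ 2 χ x‖ ≤ k₂ * L.indicator (fun _ => (1 : ℝ)) x) :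
    |a1 kStar 1 V (fun y => χ y • G y)| ≤
      (2 * A₁ + kStar) * ‖curlCLM‖ * (g₁ * (∫ x in S, ‖curl V x‖) + k₁ * g₀ * (∫ x in L, ‖curl V x‖)) +
      (g₁ * (∫ x in S, zd V x) + k₁ * g₀ * (∫ x in L, zd V x)) +
      3 * kStar * ‖curlCLM‖ * (g₂ * (∫ x in S, Real.sqrt (wd V x)) +
        (2 * k₁ * g₁ + k₂ * g₀) * (∫ x in L, Real.sqrt (wd V x))) := by
  have hK : 0 < kStar := kStar_pos
  have hc0 : 0 ≤ ‖curlCLM‖ := norm_nonneg curlCLM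
  have hA0 : 0 ≤ A₁ := (norm_nonneg _).trans (hA 0)
  have hk₁0 : 0 ≤ k₁ * L.indicator (fun _ => (1 : ℝ)) 0 := (norm_nonneg _).trans (hk₁ 0)
  have hr : ContDiff ℝ (⊤ : ℕ∞) (fun y => χ y • G y) := hχ.smul hG
  -- continuity of the three weights
  have cω : Continuous fun x => ‖curl V x‖ := (continuous_curl (hV.of_le (by norm_cast))).norm
  have czd : Continuous (zd V) := continuous_zd' hV
  have cwd : Continuous fun x => Real.sqrt (wd V x) := (continuous_wd' hV).sqrt
  -- the six weighted integrals (before the shorthands, so that `set` rewrites them)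
  obtain ⟨i1, e1⟩ := integral_indicator_mul_eq cω hSm hSb g₁
  obtain ⟨i2, e2⟩ := integral_indicator_mul_eq cω hLm hLb (k₁ * g₀)
  obtain ⟨i3, e3⟩ := integral_indicator_mul_eq czd hSm hSb g₁
  obtain ⟨i4, e4⟩ := integral_indicator_mul_eq czd hLm hLb (k₁ * g₀)
  obtain ⟨i5, e5⟩ := integral_indicator_mul_eq cwd hSm hSb g₂
  obtain ⟨i6, e6⟩ := integral_indicator_mul_eq cwd hLm hLb (2 * k₁ * g₁ + k₂ * g₀)
  -- indicator shorthands
  set iS : E3 → ℝ := S.indicator (fun _ => (1 : ℝ)) with hiS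
  set iL : E3 → ℝ := L.indicator (fun _ => (1 : ℝ)) with hiL
  have hiS01 : ∀ x, 0 ≤ iS x ∧ iS x ≤ 1 := fun x => by
    by_cases hx : x ∈ S <;> simp [hiS, hx]
  have hiL01 : ∀ x, 0 ≤ iL x ∧ iL x ≤ 1 := fun x => by
    by_cases hx : x ∈ L <;> simp [hiL, hx]
  -- the majorant
  set M : E3 → ℝ := fun x =>
    (2 * A₁ + kStar) * ‖curlCLM‖ * (g₁ * iS x * ‖curl V x‖ + k₁ * g₀ * iL x * ‖curl V x‖) +
    (g₁ * iS x * zd V x + k₁ * g₀ * iL x * zd V x) +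
    3 * kStar * ‖curlCLM‖ * (g₂ * iS x * Real.sqrt (wd V x) + (2 * k₁ * g₁ + k₂ * g₀) * iL x * Real.sqrt (wd V x))
    with hM
  -- pointwise bound
  have hpt : ∀ x, ‖c1 V (fun y => χ y • G y) x - (kStar / 2) * ((1 : ℝ)⁻¹ * (2 * z1 V (fun y => χ y • G y) x) +
      1 * (2 * w1 V (fun y => χ y • G y) x))‖ ≤ M x := by
    intro x
    rw [Real.norm_eq_abs]
    have hω0 : 0 ≤ ‖curl V x‖ := norm_nonneg _
    have hzd0 : 0 ≤ zd V x := by unfold zd; positivity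
    have hwd0 : 0 ≤ Real.sqrt (wd V x) := Real.sqrt_nonneg _
    have hk₁x : 0 ≤ k₁ * iL x := (norm_nonneg _).trans (hk₁ x)
    have hk₂x : 0 ≤ k₂ * iL x := (norm_nonneg _).trans (hk₂ x)
    by_cases hxT : x ∈ T
    · have h := abs_a1Integrand_le (V := V) hr (hA x)
      have hm₁ : ‖fderiv ℝ (fun y => χ y • G y) x‖ ≤ g₁ * iS x + k₁ * g₀ * iL x := by
        calc ‖fderiv ℝ (fun y => χ y • G y) x‖ ≤ |χ x| * ‖fderiv ℝ G x‖ + ‖fderiv ℝ χ x‖ * ‖G x‖ :=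
              norm_fderiv_smul_le hχ hG x
          _ ≤ iS x * g₁ + (k₁ * iL x) * g₀ :=
              add_le_add (mul_le_mul (hχS x) (hg₁ x hxT) (norm_nonneg _) (hiS01 x).1)
                (mul_le_mul (hk₁ x) (hg₀ x hxT) (norm_nonneg _) hk₁x)
          _ = g₁ * iS x + k₁ * g₀ * iL x := by ring
      have hm₂ : ‖iteratedFDeriv ℝ 2 (fun y => χ y • G y) x‖ ≤ g₂ * iS x + (2 * k₁ * g₁ + k₂ * g₀) * iL x := by
        calc ‖iteratedFDeriv ℝ 2 (fun y => χ y • G y) x‖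
            ≤ |χ x| * ‖iteratedFDeriv ℝ 2 G x‖ + 2 * ‖fderiv ℝ χ x‖ * ‖fderiv ℝ G x‖ + ‖iteratedFDeriv ℝ 2 χ x‖ * ‖G x‖ :=
              norm_iteratedFDeriv_two_smul_le hχ hG x
          _ ≤ iS x * g₂ + 2 * (k₁ * iL x) * g₁ + (k₂ * iL x) * g₀ := by
              refine add_le_add (add_le_add ?_ ?_) ?_
              · exact mul_le_mul (hχS x) (hg₂ x hxT) (norm_nonneg _) (hiS01 x).1
              · rw [mul_assoc, mul_assoc]
                exact mul_le_mul_of_nonneg_left (mul_le_mul (hk₁ x) (hg₁ x hxT) (norm_nonneg _) hk₁x) (by norm_num)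
              · exact mul_le_mul (hk₂ x) (hg₀ x hxT) (norm_nonneg _) hk₂x
          _ = g₂ * iS x + (2 * k₁ * g₁ + k₂ * g₀) * iL x := by ring
      refine h.trans ?_
      rw [hM]
      have e1 : ‖curl V x‖ ^ 2 = zd V x := rfl
      rw [e1]
      have c1' : 0 ≤ (2 * A₁ + kStar) * ‖curlCLM‖ := by positivity
      have c2' : 0 ≤ 3 * kStar * ‖curlCLM‖ := by positivity
      have t1 : (2 * A₁ + kStar) * ‖curlCLM‖ * ‖fderiv ℝ (fun y => χ y • G y) x‖ * ‖curl V x‖ ≤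
          (2 * A₁ + kStar) * ‖curlCLM‖ * (g₁ * iS x * ‖curl V x‖ + k₁ * g₀ * iL x * ‖curl V x‖) := by
        have h3 := mul_le_mul_of_nonneg_left (mul_le_mul_of_nonneg_right hm₁ hω0) c1'
        calc (2 * A₁ + kStar) * ‖curlCLM‖ * ‖fderiv ℝ (fun y => χ y • G y) x‖ * ‖curl V x‖
            = (2 * A₁ + kStar) * ‖curlCLM‖ * (‖fderiv ℝ (fun y => χ y • G y) x‖ * ‖curl V x‖) := by ring
          _ ≤ (2 * A₁ + kStar) * ‖curlCLM‖ * ((g₁ * iS x + k₁ * g₀ * iL x) * ‖curl V x‖) := h3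
          _ = _ := by ring
      have t2 : ‖fderiv ℝ (fun y => χ y • G y) x‖ * zd V x ≤ g₁ * iS x * zd V x + k₁ * g₀ * iL x * zd V x := by
        have h3 := mul_le_mul_of_nonneg_right hm₁ hzd0
        calc ‖fderiv ℝ (fun y => χ y • G y) x‖ * zd V x ≤ (g₁ * iS x + k₁ * g₀ * iL x) * zd V x := h3
          _ = _ := by ring
      have t3 : 3 * kStar * ‖curlCLM‖ * ‖iteratedFDeriv ℝ 2 (fun y => χ y • G y) x‖ * Real.sqrt (wd V x) ≤
          3 * kStar * ‖curlCLM‖ * (g₂ * iS x * Real.sqrt (wd V x) +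
            (2 * k₁ * g₁ + k₂ * g₀) * iL x * Real.sqrt (wd V x)) := by
        have h3 := mul_le_mul_of_nonneg_left (mul_le_mul_of_nonneg_right hm₂ hwd0) c2'
        calc 3 * kStar * ‖curlCLM‖ * ‖iteratedFDeriv ℝ 2 (fun y => χ y • G y) x‖ * Real.sqrt (wd V x)
            = 3 * kStar * ‖curlCLM‖ * (‖iteratedFDeriv ℝ 2 (fun y => χ y • G y) x‖ * Real.sqrt (wd V x)) := by ring
          _ ≤ 3 * kStar * ‖curlCLM‖ * ((g₂ * iS x + (2 * k₁ * g₁ + k₂ * g₀) * iL x) * Real.sqrt (wd V x)) := h3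
          _ = _ := by ring
      linarith
    · have hx : x ∉ tsupport χ := fun h => hxT (hT h)
      rw [a1Integrand_eq_zero_of_notMem_tsupport hx, abs_zero, hM]
      have hS0 : 0 ≤ iS x := (hiS01 x).1
      have hkk : 0 ≤ (2 * k₁ * g₁ + k₂ * g₀) * iL x := by
        have e : (2 * k₁ * g₁ + k₂ * g₀) * iL x = 2 * g₁ * (k₁ * iL x) + g₀ * (k₂ * iL x) := by ring
        rw [e]
        exact add_nonneg (mul_nonneg (by positivity) hk₁x) (mul_nonneg hg₀0 hk₂x)
      have u1 : 0 ≤ g₁ * iS x * ‖curl V x‖ := by positivity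
      have u2 : 0 ≤ k₁ * g₀ * iL x * ‖curl V x‖ := by
        have e : k₁ * g₀ * iL x * ‖curl V x‖ = g₀ * (k₁ * iL x) * ‖curl V x‖ := by ring
        rw [e]; exact mul_nonneg (mul_nonneg hg₀0 hk₁x) hω0
      have u3 : 0 ≤ g₁ * iS x * zd V x := by positivity
      have u4 : 0 ≤ k₁ * g₀ * iL x * zd V x := by
        have e : k₁ * g₀ * iL x * zd V x = g₀ * (k₁ * iL x) * zd V x := by ring
        rw [e]; exact mul_nonneg (mul_nonneg hg₀0 hk₁x) hzd0
      have u5 : 0 ≤ g₂ * iS x * Real.sqrt (wd V x) := by positivity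
      have u6 : 0 ≤ (2 * k₁ * g₁ + k₂ * g₀) * iL x * Real.sqrt (wd V x) := mul_nonneg hkk hwd0
      have c1' : 0 ≤ (2 * A₁ + kStar) * ‖curlCLM‖ := by positivity
      have c2' : 0 ≤ 3 * kStar * ‖curlCLM‖ := by positivity
      show 0 ≤ _
      have := mul_nonneg c1' (add_nonneg u1 u2)
      have := mul_nonneg c2' (add_nonneg u5 u6)
      linarith
  -- integrate the majorant
  have iA : Integrable (fun x => (2 * A₁ + kStar) * ‖curlCLM‖ *
      (g₁ * iS x * ‖curl V x‖ + k₁ * g₀ * iL x * ‖curl V x‖)) := (i1.add i2).const_mul _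
  have iB : Integrable (fun x => g₁ * iS x * zd V x + k₁ * g₀ * iL x * zd V x) := i3.add i4
  have iC : Integrable (fun x => 3 * kStar * ‖curlCLM‖ *
      (g₂ * iS x * Real.sqrt (wd V x) + (2 * k₁ * g₁ + k₂ * g₀) * iL x * Real.sqrt (wd V x))) :=
    (i5.add i6).const_mul _
  have iAB : Integrable (fun x => (2 * A₁ + kStar) * ‖curlCLM‖ *
      (g₁ * iS x * ‖curl V x‖ + k₁ * g₀ * iL x * ‖curl V x‖) +
      (g₁ * iS x * zd V x + k₁ * g₀ * iL x * zd V x)) := iA.add iB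
  have hMint : Integrable M := by
    simp only [hM]
    exact iAB.add iC
  have hmain := norm_integral_le_of_norm_le hMint (Eventually.of_forall hpt)
  unfold a1
  rw [Real.norm_eq_abs] at hmain
  refine hmain.trans (le_of_eq ?_)
  simp only [hM]
  rw [integral_add iAB iC, integral_add iA iB, integral_const_mul, integral_const_mul,
    integral_add i1 i2, integral_add i3 i4, integral_add i5 i6, e1, e2, e3, e4, e5, e6]

end Summit.NavierStokesRegularity.NavierStokesRegularity.Theorems.NearExtremalTransiencePerFlow.TwoThirds

end
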